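import Mathlib
import HarnessLib
import Summits.Ventures.LatticeQCDFlow.Scaling.IdentityFlowStrictLaws
import Summits.Ventures.LatticeQCDFlow.Scaling.WilsonIdentityFlowLaw2D
import Summits.Ventures.LatticeQCDFlow.Scaling.CorrelatorFloorTwoDimU1

/-!
# LatticeQCDFlow / Scaling — the Wilson action is not identically zero (one rotated link), so the
# untrained sampler of every Wilson theory with `L ≥ 2`, two directions and a non-maximal trace
# has `ESS < 1` and `acc < Z(β/2)²/Z(β)` STRICTLY; U(1) and SU(2) instances

HONEST FRAMING: exact (Metropolis-corrected) sampling algorithms for lattice gauge theory;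
figures of merit are autocorrelation/cost numbers at stated couplings and volumes; no
continuum-physics claim.

Venture `LatticeQCDFlow` (cell pub-lqcd), topic `Scaling`; FANOUT row 3 (`s0-u1-a`, S0-B
implementation A, GEN-14).  NEW WORK of the cell (elementary), discharging the hypothesis
`∃ U₀, S(U₀) ≠ 0` of row 3's `wilsonTilt_not_ae_one_haar` / `wilsonIdentityFlow_essFrac_lt_one_haar` /
`wilsonIdentityFlow_meanAccept_lt_haar` (`Scaling/IdentityFlowStrictLaws`, imported; the Borel structure
on `Circle` arrives with `Scaling/WilsonIdentityFlowLaw2D`) in theory-2's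
Wilson lattice gauge theory (`Literature…ConstructiveQFTWave0`: torus `(ℤ/L)^d`, compact `G`,
continuous matrix representation `ρ : G →* M_N(ℂ)`, `S(U) = Σ_p (N − Re tr ρ(U_p))`).
NO definition is introduced.

* §1 `Site.shift_ne_self` (`L ≥ 2`: a unit shift moves every site);
  **`plaquetteHolonomy_update_single`** — the configuration with ONE link `(x₀, i)` set to `g` and
  all other links trivial has holonomy `g` around the plaquette at `x₀` in an `(i, j)` plane, `j ≠ i`;
* §2 **`wilsonAction_update_single_pos`** — its action is `≥ N − Re tr ρ(g) > 0` whenever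
  `Re tr ρ(g) ≠ N` (every plaquette term is `≥ 0` by the unitary-trick bound
  `|Re tr ρ| ≤ N` of `Literature.RepresentationTheory.CompactGroups`, continuous `ρ`); hence
  `exists_wilsonAction_ne_zero`;
* §3 the strict laws of the untrained sampler (`μ = Haar^{⊗E}`) for EVERY `L ≥ 2`, every pair of
  directions `i < j` (so `d ≥ 2`), every `β ≠ 0` and every continuous `ρ` with a non-maximal trace
  value: **`wilsonIdentityFlow_essFrac_lt_one_of_trace`** (`Z(β)² < Z(2β)`),
  **`wilsonIdentityFlow_meanAccept_lt_of_trace`** (`acc < Z(β/2)²/Z(β)`), `Z = partitionFunction`;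
* §4 instances: U(1) (`u1Rep`, `Re tr ρ(e^{iπ}) = −1 ≠ 1`: the tree's
  `Lattice.TwoDim.exists_u1_trace_re_ne` of `Scaling/CorrelatorFloorTwoDimU1`, imported) and SU(2)
  (`fundamentalRep (Fin 2)`, `Re tr(−1) = −2 ≠ 2`: `su2_exists_trace_ne`), giving the unconditional
  **`u1IdentityFlow_torus_essFrac_lt_one`**, **`u1IdentityFlow_torus_meanAccept_lt`**,
  **`su2IdentityFlow_torus_essFrac_lt_one`**, **`su2IdentityFlow_torus_meanAccept_lt`** on every torus
  `(ℤ/L)^d`, `L ≥ 2`, `d ≥ 2`.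

Reading (value-free): on every periodic lattice with at least two sites per direction and two
directions, the untrained exact sampler of compact U(1) and of SU(2) lattice gauge theory at any
`β ≠ 0` has effective sample size strictly below `1` per configuration draw ratio `Z(β)²/Z(2β) < 1`
and equilibrium acceptance strictly below its Bhattacharyya ceiling `Z(β/2)²/Z(β)`.  NOT CLAIMED:
`L = 1` (for abelian `G` the action then vanishes identically); the size of the gap; any value at the
cell's `(β, L)`; nothing re-scored.
-/

noncomputable section

namespace Summit.Ventures.LatticeQCDFlow.Theory2

open MeasureTheory Real Finset Filter
open Literature.MathematicalPhysics.QuantumFieldTheory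
open Literature.MathematicalPhysics.QuantumLattice (fundamentalRep fundamentalRep_apply
  continuous_fundamentalRep u1Rep u1Rep_apply continuous_u1Rep)

/-! ## §1 One rotated link -/

section OneLink

variable {d L : ℕ} {G : Type*} [Group G]

/-- On a torus with `L ≥ 2` sites per direction a unit shift moves every site. [folklore] -/
theorem Site.shift_ne_self [Fact (1 < L)] (x : Site d L) (j : Fin d) : x.shift j ≠ x := by
  intro h
  have h1 : (Pi.single j (1 : ZMod L) : Site d L) = 0 := by
    have h' : x + Pi.single j 1 = x := h
    exact add_eq_left.1 h'
  have h2 := congrFun h1 j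
  simp at h2

/-- **ONE ROTATED LINK**: the configuration with the link `(x₀, i)` set to `g` and every other link
trivial has holonomy `g` around the plaquette at `x₀` in the `(i, j)` plane (`j ≠ i`, `L ≥ 2`).
[folklore] -/
theorem plaquetteHolonomy_update_single [Fact (1 < L)] (x₀ : Site d L) {i j : Fin d} (hij : i ≠ j)
    (g : G) :
    plaquetteHolonomy (Function.update (1 : GaugeConfig d L G) (x₀, i) g) x₀ i j = g := by
  unfold plaquetteHolonomy
  have h2 : Function.update (1 : GaugeConfig d L G) (x₀, i) g (x₀.shift i, j) = 1 := by
    rw [Function.update_of_ne (fun h => hij (congrArg Prod.snd h).symm), Pi.one_apply]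
  have h3 : Function.update (1 : GaugeConfig d L G) (x₀, i) g (x₀.shift j, i) = 1 := by
    rw [Function.update_of_ne (fun h => Site.shift_ne_self x₀ j (congrArg Prod.fst h)),
      Pi.one_apply]
  have h4 : Function.update (1 : GaugeConfig d L G) (x₀, i) g (x₀, j) = 1 := by
    rw [Function.update_of_ne (fun h => hij (congrArg Prod.snd h).symm), Pi.one_apply]
  rw [Function.update_self, h2, h3, h4, mul_one, inv_one, mul_one, mul_one]

end OneLink

/-! ## §2 Its action is positive -/

section Action

variable {d L N : ℕ} [NeZero L] {G : Type*} [Group G] [TopologicalSpace G] [IsTopologicalGroup G]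
  [CompactSpace G] (ρ : G →* Matrix (Fin N) (Fin N) ℂ)

/-- **THE ONE-LINK CONFIGURATION HAS POSITIVE ACTION**: `S ≥ N − Re tr ρ(g) > 0` whenever
`Re tr ρ(g) ≠ N` (`L ≥ 2`, directions `i < j`, continuous `ρ`). [ours] -/
theorem wilsonAction_update_single_pos [Fact (1 < L)] (hρ : Continuous ρ) (x₀ : Site d L)
    {i j : Fin d} (hij : i < j) {g : G} (hg : (ρ g).trace.re ≠ N) :
    0 < wilsonAction ρ (Function.update (1 : GaugeConfig d L G) (x₀, i) g) := by
  -- `Re tr ρ(h) ≤ N` (unitary trick, `Literature.RepresentationTheory.CompactGroups`)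
  have hle : ∀ h : G, (ρ h).trace.re ≤ N := fun h => by
    have hb := Literature.RepresentationTheory.CompactGroups.CompactGroup.abs_re_trace_le_card ρ hρ h
    rw [Fintype.card_fin] at hb
    exact (le_abs_self _).trans hb
  unfold wilsonAction
  set U₀ : GaugeConfig d L G := Function.update (1 : GaugeConfig d L G) (x₀, i) g with hU₀
  set p₀ : Plaquette d L := (x₀, ⟨(i, j), hij⟩) with hp₀
  have hterm : 0 < (N : ℝ) - (ρ (plaquetteHolonomy U₀ p₀.1 p₀.2.1.1 p₀.2.1.2)).trace.re := by
    show 0 < (N : ℝ) - (ρ (plaquetteHolonomy U₀ x₀ i j)).trace.re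
    rw [hU₀, plaquetteHolonomy_update_single x₀ hij.ne g]
    exact sub_pos.2 (lt_of_le_of_ne (hle g) hg)
  exact lt_of_lt_of_le hterm (Finset.single_le_sum
    (f := fun p : Plaquette d L => (N : ℝ) - (ρ (plaquetteHolonomy U₀ p.1 p.2.1.1 p.2.1.2)).trace.re)
    (fun p _ => sub_nonneg.2 (hle _)) (Finset.mem_univ p₀))

/-- **THE WILSON ACTION IS NOT IDENTICALLY ZERO** on a torus with `L ≥ 2`, two directions `i < j`,
and a representation with a non-maximal trace value. [ours] -/
theorem exists_wilsonAction_ne_zero [Fact (1 < L)] (hρ : Continuous ρ) {i j : Fin d} (hij : i < j)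
    (hg : ∃ g : G, (ρ g).trace.re ≠ N) :
    ∃ U₀ : GaugeConfig d L G, wilsonAction ρ U₀ ≠ 0 := by
  obtain ⟨g, hg⟩ := hg
  exact ⟨_, (wilsonAction_update_single_pos ρ hρ 0 hij hg).ne'⟩

end Action

/-! ## §3 The strict laws of the untrained sampler, discharged -/

section Strict

variable {d L N : ℕ} [NeZero L] [Fact (1 < L)] {G : Type*} [Group G] [TopologicalSpace G]
  [IsTopologicalGroup G] [CompactSpace G] [MeasurableSpace G] [BorelSpace G]
  (ρ : G →* Matrix (Fin N) (Fin N) ℂ)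

/-- **`Z(β)² < Z(2β)` (`ESS < 1`) for the untrained sampler** of every Wilson theory on `(ℤ/L)^d`,
`L ≥ 2`, directions `i < j`, `β ≠ 0`, continuous `ρ` with a non-maximal trace value
(`Z = (partitionFunction ρ ·).toReal`). [ours] -/
theorem wilsonIdentityFlow_essFrac_lt_one_of_trace (hρ : Continuous ρ) {β : ℝ} (hβ : β ≠ 0)
    {i j : Fin d} (hij : i < j) (hg : ∃ g : G, (ρ g).trace.re ≠ N) :
    (partitionFunction (d := d) (L := L) ρ β).toReal ^ 2
        / (partitionFunction (d := d) (L := L) ρ (2 * β)).toReal < 1 :=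
  wilsonIdentityFlow_essFrac_lt_one_haar ρ hρ hβ (exists_wilsonAction_ne_zero ρ hρ hij hg)

/-- **`acc < Z(β/2)²/Z(β)` STRICTLY for the untrained sampler** of every such Wilson theory. [ours] -/
theorem wilsonIdentityFlow_meanAccept_lt_of_trace (hρ : Continuous ρ) {β : ℝ} (hβ : β ≠ 0)
    {i j : Fin d} (hij : i < j) (hg : ∃ g : G, (ρ g).trace.re ≠ N) :
    ∫ U, ∫ U', min (Real.exp (-β * wilsonAction ρ U) / ∫ V, Real.exp (-β * wilsonAction ρ V)
            ∂(Measure.pi fun _ : Edge d L => haarProbability G))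
        (Real.exp (-β * wilsonAction ρ U') / ∫ V, Real.exp (-β * wilsonAction ρ V)
            ∂(Measure.pi fun _ : Edge d L => haarProbability G))
        ∂(Measure.pi fun _ : Edge d L => haarProbability G)
        ∂(Measure.pi fun _ : Edge d L => haarProbability G)
      < (partitionFunction (d := d) (L := L) ρ (β / 2)).toReal ^ 2
          / (partitionFunction (d := d) (L := L) ρ β).toReal :=
  wilsonIdentityFlow_meanAccept_lt_haar ρ hρ hβ (exists_wilsonAction_ne_zero ρ hρ hij hg)

end Strict

/-! ## §4 U(1) and SU(2) -/

section Instances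

/-- `Re tr(−1) = −2 ≠ 2` for the fundamental representation of SU(2) (`−1 ∈ SU(2)`: unitary with
`det(−1) = (−1)² = 1`). [folklore] -/
theorem su2_exists_trace_ne :
    ∃ g : Matrix.specialUnitaryGroup (Fin 2) ℂ, (fundamentalRep (Fin 2) g).trace.re ≠ 2 := by
  have hmem : (-1 : Matrix (Fin 2) (Fin 2) ℂ) ∈ Matrix.specialUnitaryGroup (Fin 2) ℂ := by
    rw [Matrix.mem_specialUnitaryGroup_iff, Matrix.mem_unitaryGroup_iff]
    refine ⟨by simp, ?_⟩
    rw [Matrix.det_neg, Matrix.det_one, Fintype.card_fin]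
    norm_num
  refine ⟨⟨-1, hmem⟩, ?_⟩
  rw [fundamentalRep_apply]
  simp [Matrix.trace]
  norm_num

variable {d L : ℕ} [NeZero L] [Fact (1 < L)]

/-- **U(1), unconditionally**: `Z(β)² < Z(2β)` for the untrained sampler of compact U(1) lattice gauge
theory on `(ℤ/L)^d`, `L ≥ 2`, directions `i < j`, `β ≠ 0`. [ours] -/
theorem u1IdentityFlow_torus_essFrac_lt_one {β : ℝ} (hβ : β ≠ 0) {i j : Fin d} (hij : i < j) :
    (partitionFunction (d := d) (L := L) u1Rep β).toReal ^ 2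
        / (partitionFunction (d := d) (L := L) u1Rep (2 * β)).toReal < 1 :=
  wilsonIdentityFlow_essFrac_lt_one_of_trace u1Rep continuous_u1Rep hβ hij
    Lattice.TwoDim.exists_u1_trace_re_ne

/-- **U(1), unconditionally**: `acc < Z(β/2)²/Z(β)` for the untrained sampler of compact U(1) lattice
gauge theory on `(ℤ/L)^d`, `L ≥ 2`, directions `i < j`, `β ≠ 0`. [ours] -/
theorem u1IdentityFlow_torus_meanAccept_lt {β : ℝ} (hβ : β ≠ 0) {i j : Fin d} (hij : i < j) :
    ∫ U, ∫ U', min (Real.exp (-β * wilsonAction u1Rep U) / ∫ V, Real.exp (-β * wilsonAction u1Rep V)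
            ∂(Measure.pi fun _ : Edge d L => haarProbability Circle))
        (Real.exp (-β * wilsonAction u1Rep U') / ∫ V, Real.exp (-β * wilsonAction u1Rep V)
            ∂(Measure.pi fun _ : Edge d L => haarProbability Circle))
        ∂(Measure.pi fun _ : Edge d L => haarProbability Circle)
        ∂(Measure.pi fun _ : Edge d L => haarProbability Circle)
      < (partitionFunction (d := d) (L := L) u1Rep (β / 2)).toReal ^ 2
          / (partitionFunction (d := d) (L := L) u1Rep β).toReal :=
  wilsonIdentityFlow_meanAccept_lt_of_trace u1Rep continuous_u1Rep hβ hij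
    Lattice.TwoDim.exists_u1_trace_re_ne

/-- **SU(2), unconditionally**: `Z(β)² < Z(2β)` for the untrained sampler of SU(2) lattice gauge theory
on `(ℤ/L)^d`, `L ≥ 2`, directions `i < j`, `β ≠ 0`. [ours] -/
theorem su2IdentityFlow_torus_essFrac_lt_one {β : ℝ} (hβ : β ≠ 0) {i j : Fin d} (hij : i < j) :
    (partitionFunction (d := d) (L := L) (fundamentalRep (Fin 2)) β).toReal ^ 2
        / (partitionFunction (d := d) (L := L) (fundamentalRep (Fin 2)) (2 * β)).toReal < 1 :=
  wilsonIdentityFlow_essFrac_lt_one_of_trace (fundamentalRep (Fin 2)) (continuous_fundamentalRep _)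
    hβ hij su2_exists_trace_ne

/-- **SU(2), unconditionally**: `acc < Z(β/2)²/Z(β)` for the untrained sampler of SU(2) lattice gauge
theory on `(ℤ/L)^d`, `L ≥ 2`, directions `i < j`, `β ≠ 0`. [ours] -/
theorem su2IdentityFlow_torus_meanAccept_lt {β : ℝ} (hβ : β ≠ 0) {i j : Fin d} (hij : i < j) :
    ∫ U, ∫ U', min (Real.exp (-β * wilsonAction (fundamentalRep (Fin 2)) U)
          / ∫ V, Real.exp (-β * wilsonAction (fundamentalRep (Fin 2)) V)
            ∂(Measure.pi fun _ : Edge d L => haarProbability (Matrix.specialUnitaryGroup (Fin 2) ℂ)))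
        (Real.exp (-β * wilsonAction (fundamentalRep (Fin 2)) U')
          / ∫ V, Real.exp (-β * wilsonAction (fundamentalRep (Fin 2)) V)
            ∂(Measure.pi fun _ : Edge d L => haarProbability (Matrix.specialUnitaryGroup (Fin 2) ℂ)))
        ∂(Measure.pi fun _ : Edge d L => haarProbability (Matrix.specialUnitaryGroup (Fin 2) ℂ))
        ∂(Measure.pi fun _ : Edge d L => haarProbability (Matrix.specialUnitaryGroup (Fin 2) ℂ))
      < (partitionFunction (d := d) (L := L) (fundamentalRep (Fin 2)) (β / 2)).toReal ^ 2
          / (partitionFunction (d := d) (L := L) (fundamentalRep (Fin 2)) β).toReal :=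
  wilsonIdentityFlow_meanAccept_lt_of_trace (fundamentalRep (Fin 2)) (continuous_fundamentalRep _)
    hβ hij su2_exists_trace_ne

end Instances

end Summit.Ventures.LatticeQCDFlow.Theory2
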